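import Summits.BirchSwinnertonDyer.BirchSwinnertonDyer.Theses.PrintX10b
import Summits.BirchSwinnertonDyer.BirchSwinnertonDyer.Theorems.PrintX10bResplitClosersCoherentPair

set_option linter.dupNamespace false -- nested cell layout (D-0017)

/-!
# PrintX10b — ROUND 3 entry glue `HowardContainmentLightFrameX10bPinnedOfPrintOfPrintMuCG` (turnkey, plan g12)

One-line closer of the definitional glue item of ROUND 3 ((CG) Greenberg LNM 1716 Prop. 2.4 by name), twin of
`PrintX9PrintMuCGEntry`.  The three print leaves are HYPOTHESES stated by name; bookkeeping only; BSD is not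
proved by any of this.
-/

namespace Summit.BirchSwinnertonDyer.BirchSwinnertonDyer.Theorems.PrintX10bPrintMuCGEntry

open Summit.BirchSwinnertonDyer.BirchSwinnertonDyer.Theses.PrintX10b

/-- closes the route item `PrintX10b.HowardContainmentLightFrameX10bPinnedOfPrintOfPrintMuCG`. -/
theorem howardContainmentLightFrameX10bPinnedOfPrintOfPrintMuCG_holds :
    HowardContainmentLightFrameX10bPinnedOfPrintOfPrintMuCG :=
  fun hM hH hK hCG =>
    Summit.BirchSwinnertonDyer.BirchSwinnertonDyer.Theorems.PrintX10bResplit.howardContainmentLightFrameX10bPinnedOfPrintOfCoherentPair_holds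
      (hM hH hK hCG)
      Summit.BirchSwinnertonDyer.BirchSwinnertonDyer.Theorems.PrintX10bResplit.printHypothesesDischargeX10b_holds

end Summit.BirchSwinnertonDyer.BirchSwinnertonDyer.Theorems.PrintX10bPrintMuCGEntry
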